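import Literature.Analysis.ValidatedNumerics.MultiPrecisionInterval
import HarnessLib

/-!
# Interval enclosures of `log x`, `arctan x` and the complex logarithm (multi-precision engine)

Topic `Literature/Analysis/ValidatedNumerics`; extends the multi-precision fixed-point interval
engine `MultiPrecisionInterval.lean` (`Literature.Analysis.ValidatedNumerics.NumericsMP.MI`/`MC`,
scale `S`) by three enclosures that file lacks, each a total computable function on `ℤ` with an
inclusion theorem, reducible in the kernel (`decide +kernel`; no well-founded recursion — the
binary exponent is `Nat.log2`):

* `MI.logNat2` (`= MI.logNat`, with `Nat.log2`), `MI.logScaled S K p` (`log (p/S)` for a scaled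
  point `p > 0`), `MI.logPos S K X` — `log x` on an interval `X` with positive lower end
  (monotonicity between the endpoint values);
* `MI.arctanSmall S K Y` (`|y| ≤ ½`, Gregory's series with the tail `(4/3)|y|^{2K+1}`),
  `MI.arctanNat`/`MI.arctanPt S K piI p` (`arctan (p/S)` for any scaled point, by the reductions
  `arctan x = π/4 + arctan ((x−1)/(x+1))` on `[½, 2]` and `arctan x = π/2 − arctan (1/x)` beyond,
  with a supplied enclosure `piI ∋ π`), `MI.arctan S K piI X` (monotonicity);
* `MC.logUpper S K piI B` — the principal logarithm of a box `B` in the open upper half-plane: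
  `re = ½ log (re² + im²)`, `im = arg = π/2 − arctan (re/im)` (`arg_eq_pi_div_two_sub_arctan`).

Inclusion theorems: `MI.mem_logNat2`, `MI.mem_logScaled`, `MI.mem_logPos`, `MI.mem_arctanSmall`,
`MI.mem_arctanNat`, `MI.mem_arctanPt`, `MI.mem_arctan`, `MC.mem_logUpper`.

## References

* R. E. Moore, *Interval Analysis*, Prentice-Hall 1966, Ch. 3–4 (interval extensions of monotone
  and elementary functions). [folklore]
-/

open Real Complex Finset

namespace Literature.Analysis.ValidatedNumerics.NumericsMP

variable {S : ℕ} {x y : ℝ} {X Y I J : MI}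

namespace MI

/-! ### `log` -/

/-- `MI.logNat` with the binary exponent computed by `Nat.log2` (structural, kernel-friendly)
instead of `Nat.log 2`. [folklore] -/
def logNat2 (S K : ℕ) (n : ℕ) : Option MI :=
  if n = 0 then none else
    let k := Nat.log2 n
    match logTwo S K, logOneSub S K (ofFrac S ((n : ℤ) - (2 : ℤ) ^ k) n) with
    | some L2, some Y => some ((L2.mulInt k).sub Y)
    | _, _ => none

/-- `logNat2 = logNat`. [folklore] -/
theorem logNat2_eq (S K n : ℕ) : logNat2 S K n = logNat S K n := by
  simp only [logNat2, logNat, Nat.log2_eq_log_two]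
  rfl

/-- [folklore] -/
theorem mem_logNat2 (hS : 0 < S) {K n : ℕ} {Y : MI} (h : logNat2 S K n = some Y) :
    mem S (Real.log n) Y :=
  mem_logNat hS (by rwa [logNat2_eq] at h)

/-- Enclosure of `log (p / S)` for a scaled point `p > 0` (`none` if `p ≤ 0`):
`log (p/S) = log p − log S`. [folklore] -/
def logScaled (S K : ℕ) (p : ℤ) : Option MI :=
  if 0 < p then
    match logNat2 S K p.toNat, logNat2 S K S with
    | some A, some B => some (A.sub B)
    | _, _ => none
  else none

/-- [folklore] -/
theorem mem_logScaled (hS : 0 < S) {K : ℕ} {p : ℤ} {Y : MI} (h : logScaled S K p = some Y) :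
    0 < p ∧ mem S (Real.log ((p : ℝ) / S)) Y := by
  unfold logScaled at h
  split_ifs at h with hp
  split at h
  · rename_i A B hA hB
    simp only [Option.some.injEq] at h
    subst h
    refine ⟨hp, ?_⟩
    have h1 := mem_logNat2 hS hA
    have h2 := mem_logNat2 hS hB
    have ep : ((p.toNat : ℕ) : ℝ) = (p : ℝ) := by
      have : (p.toNat : ℤ) = p := Int.toNat_of_nonneg hp.le
      exact_mod_cast this
    rw [ep] at h1
    have hSr : (0 : ℝ) < S := by exact_mod_cast hS
    have hpr : (0 : ℝ) < p := by exact_mod_cast hp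
    rw [Real.log_div hpr.ne' hSr.ne']
    exact mem_sub h1 h2
  · simp at h

/-- Enclosure of `log x` on an interval with positive lower endpoint, by monotonicity between
the values at the endpoints (`none` if the lower endpoint is `≤ 0`). [folklore] -/
def logPos (S K : ℕ) (X : MI) : Option MI :=
  match logScaled S K X.lo, logScaled S K X.hi with
  | some A, some B => some ⟨A.lo, B.hi⟩
  | _, _ => none

/-- [folklore] -/
theorem mem_logPos (hS : 0 < S) {K : ℕ} {Y : MI} (h : logPos S K X = some Y) (hx : mem S x X) :
    0 < x ∧ mem S (Real.log x) Y := by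
  unfold logPos at h
  split at h
  · rename_i A B hA hB
    simp only [Option.some.injEq] at h
    subst h
    obtain ⟨hlo, hA'⟩ := mem_logScaled hS hA
    obtain ⟨-, hB'⟩ := mem_logScaled hS hB
    have hSr : (0 : ℝ) < S := by exact_mod_cast hS
    have hlor : (0 : ℝ) < X.lo := by exact_mod_cast hlo
    have hx0 : 0 < x := by
      have := hx.1
      nlinarith
    refine ⟨hx0, ?_, ?_⟩
    · have h1 : Real.log ((X.lo : ℝ) / S) ≤ Real.log x :=
        Real.log_le_log (by positivity) (by rw [div_le_iff₀ hSr]; exact hx.1)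
      simp only
      have := hA'.1
      nlinarith
    · have h1 : Real.log x ≤ Real.log ((X.hi : ℝ) / S) :=
        Real.log_le_log hx0 (by rw [le_div_iff₀ hSr]; exact hx.2)
      simp only
      have := hB'.2
      nlinarith
  · simp at h

/-! ### `arctan` -/

/-- The recurrence for Gregory's series: state `(pow, sum) = ((−1)^i y^{2i+1}, Σ_{j<i} (−1)^j
y^{2j+1}/(2j+1))`; `N` encloses `−y²`. [folklore] -/
def atanSeries (S : ℕ) (N : MI) : ℕ → ℕ → MI → MI → MI × MI
  | 0, _, pow, sum => (pow, sum)
  | n + 1, i, pow, sum => atanSeries S N n (i + 1) (pow.mul S N) (sum.add (pow.divNat (2 * i + 1)))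

/-- Enclosure of `arctan y` for an interval `Y ⊆ [−½, ½]` (`none` otherwise): `K` terms of
Gregory's series and the tail bound `|y|^{2K+1}/(1 − y²) ≤ (4/3)|y|^{2K+1}`. [folklore] -/
def arctanSmall (S K : ℕ) (Y : MI) : Option MI :=
  if 2 * Y.absHi ≤ S then
    let p := atanSeries S ((Y.sqr S).neg) K 0 Y ⟨0, 0⟩
    some (p.2.widen (Numerics.cdiv (4 * p.1.absHi) 3))
  else none

/-- Invariant of `atanSeries`. [folklore] -/
lemma atanSeries_spec (hS : 0 < S) {N : MI} (hN : mem S (-y ^ 2) N) :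
    ∀ (n i : ℕ) (pow sum : MI), mem S ((-1) ^ i * y ^ (2 * i + 1)) pow →
      mem S (∑ j ∈ range i, (-1 : ℝ) ^ j * y ^ (2 * j + 1) / ((2 * j + 1 : ℕ) : ℝ)) sum →
      mem S ((-1) ^ (i + n) * y ^ (2 * (i + n) + 1)) (atanSeries S N n i pow sum).1 ∧
        mem S (∑ j ∈ range (i + n), (-1 : ℝ) ^ j * y ^ (2 * j + 1) / ((2 * j + 1 : ℕ) : ℝ))
          (atanSeries S N n i pow sum).2
  | 0, i, pow, sum, hp, hs => by simpa [atanSeries] using And.intro hp hs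
  | n + 1, i, pow, sum, hp, hs => by
    have hp' : mem S ((-1) ^ (i + 1) * y ^ (2 * (i + 1) + 1)) (pow.mul S N) := by
      have := mem_mul hS hp hN
      convert this using 1
      ring
    have hs' : mem S (∑ j ∈ range (i + 1), (-1 : ℝ) ^ j * y ^ (2 * j + 1) / ((2 * j + 1 : ℕ) : ℝ))
        (sum.add (pow.divNat (2 * i + 1))) := by
      rw [Finset.sum_range_succ]
      refine mem_add hs ?_
      have := mem_divNat hp (show 0 < 2 * i + 1 by omega)
      push_cast at this ⊢
      exact this
    have := atanSeries_spec hS hN n (i + 1) _ _ hp' hs'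
    simp only [atanSeries]
    rw [show i + (n + 1) = i + 1 + n by ring]
    exact this

/-- Tail of Gregory's series for `|y| < 1` (odd symmetrisation of
`MI.abs_arctan_sub_sum_le`). [folklore] -/
lemma abs_arctan_sub_sum_le' {y : ℝ} (hy : |y| < 1) (K : ℕ) :
    |Real.arctan y - ∑ i ∈ range K, (-1 : ℝ) ^ i * y ^ (2 * i + 1) / ((2 * i + 1 : ℕ) : ℝ)| ≤
      |y| ^ (2 * K + 1) / (1 - y ^ 2) := by
  rcases le_or_gt 0 y with h0 | h0
  · rw [abs_of_nonneg h0] at hy ⊢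
    exact abs_arctan_sub_sum_le h0 hy K
  · have hy' : 0 ≤ -y := by linarith
    rw [abs_of_neg h0] at hy ⊢
    have h := abs_arctan_sub_sum_le hy' hy K
    have e1 : Real.arctan (-y) = -Real.arctan y := Real.arctan_neg y
    have e2 : ∑ i ∈ range K, (-1 : ℝ) ^ i * (-y) ^ (2 * i + 1) / ((2 * i + 1 : ℕ) : ℝ) =
        -∑ i ∈ range K, (-1 : ℝ) ^ i * y ^ (2 * i + 1) / ((2 * i + 1 : ℕ) : ℝ) := by
      rw [← Finset.sum_neg_distrib]
      refine Finset.sum_congr rfl fun i _ ↦ ?_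
      rw [Odd.neg_pow (n := 2 * i + 1) ⟨i, rfl⟩]
      ring
    rw [e1, e2, neg_sub_neg, abs_sub_comm, neg_sq] at h
    exact h

/-- [folklore] -/
theorem mem_arctanSmall (hS : 0 < S) {K : ℕ} {Z : MI} (h : arctanSmall S K Y = some Z)
    (hy : mem S y Y) : mem S (Real.arctan y) Z := by
  have hSr : (0 : ℝ) < S := by exact_mod_cast hS
  unfold arctanSmall at h
  split_ifs at h with hb
  simp only [Option.some.injEq] at h
  subst h
  have hya : |y| ≤ 1 / 2 := by
    have h1 := abs_le_absHi hy
    have h2 : (2 * Y.absHi : ℝ) ≤ S := by exact_mod_cast hb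
    nlinarith
  have hy1 : |y| < 1 := by linarith
  have hN : mem S (-y ^ 2) ((Y.sqr S).neg) := mem_neg (mem_sqr hS hy)
  obtain ⟨hpow, hsum⟩ := atanSeries_spec hS hN K 0 Y ⟨0, 0⟩ (by simpa using hy)
    (by simpa [ofInt] using mem_ofInt S 0)
  simp only [zero_add] at hpow hsum
  set p := atanSeries S ((Y.sqr S).neg) K 0 Y ⟨0, 0⟩ with hp
  clear_value p
  apply mem_widen hsum
  have htail := abs_arctan_sub_sum_le' hy1 K
  have hP := abs_le_absHi hpow
  rw [abs_mul, abs_pow, abs_pow, abs_neg, abs_one, one_pow, one_mul] at hP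
  have h1 : |y| ^ (2 * K + 1) / (1 - y ^ 2) ≤ 4 / 3 * |y| ^ (2 * K + 1) := by
    have hy2 : y ^ 2 ≤ 1 / 4 := by
      have : y ^ 2 = |y| ^ 2 := (sq_abs y).symm
      rw [this]; nlinarith [abs_nonneg y]
    rw [div_le_iff₀ (by linarith)]
    nlinarith [pow_nonneg (abs_nonneg y) (2 * K + 1)]
  have h2 : |Real.arctan y - ∑ j ∈ range K, (-1 : ℝ) ^ j * y ^ (2 * j + 1) / ((2 * j + 1 : ℕ) : ℝ)|
      * S ≤ ((4 * p.1.absHi : ℤ) : ℝ) / ((3 : ℤ) : ℝ) := by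
    have := mul_le_mul_of_nonneg_right (htail.trans h1) hSr.le
    refine this.trans ?_
    push_cast
    rw [le_div_iff₀ (by norm_num : (0 : ℝ) < 3)]
    nlinarith
  exact h2.trans (Numerics.div_le_cdiv (a := 4 * p.1.absHi) (b := 3) (by norm_num))

/-- Enclosure of `arctan (q / S)` for a natural scaled point `q`, given `piI ∋ π`:
directly if `q/S ≤ ½`; `π/4 + arctan ((q−S)/(q+S))` if `½ < q/S ≤ 2`; `π/2 − arctan (S/q)`
beyond. [folklore] -/
def arctanNat (S K : ℕ) (piI : MI) (q : ℕ) : Option MI :=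
  if 2 * q ≤ S then arctanSmall S K (ofScaled q)
  else if q ≤ 2 * S then
    match divPos S (ofScaled ((q : ℤ) - S)) (ofScaled ((q : ℤ) + S)) with
    | some T =>
      match arctanSmall S K T with
      | some A => some ((piI.divNat 4).add A)
      | none => none
    | none => none
  else
    match arctanSmall S K (ofFrac S S q) with
    | some A => some ((piI.divNat 2).sub A)
    | none => none

/-- [folklore] -/
theorem mem_arctanNat (hS : 0 < S) {K : ℕ} {piI : MI} (hpi : mem S Real.pi piI) {q : ℕ} {Z : MI}
    (h : arctanNat S K piI q = some Z) : mem S (Real.arctan ((q : ℝ) / S)) Z := by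
  have hSr : (0 : ℝ) < S := by exact_mod_cast hS
  unfold arctanNat at h
  split_ifs at h with h1 h2
  · have := mem_arctanSmall hS h (mem_ofScaled hS (q : ℤ))
    push_cast at this
    exact this
  · split at h
    · rename_i T hT
      split at h
      · rename_i A hA
        simp only [Option.some.injEq] at h
        subst h
        have hq : (S : ℝ) / 2 < q := by
          have : ((S : ℕ) : ℝ) < 2 * q := by exact_mod_cast not_le.mp h1
          linarith
        have ht : mem S ((((q : ℤ) - S : ℤ) : ℝ) / S / ((((q : ℤ) + S : ℤ) : ℝ) / S)) T :=
          mem_divPos hS hT (mem_ofScaled hS _) (mem_ofScaled hS _)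
        have et : (((q : ℤ) - S : ℤ) : ℝ) / S / ((((q : ℤ) + S : ℤ) : ℝ) / S) =
            ((q : ℝ) - S) / (q + S) := by
          push_cast
          field_simp
        rw [et] at ht
        have hA' := mem_arctanSmall hS hA ht
        have key : Real.arctan ((q : ℝ) / S) = Real.pi / 4 + Real.arctan (((q : ℝ) - S) / (q + S)) := by
          rw [← Real.arctan_one]
          have hlt : (1 : ℝ) * (((q : ℝ) - S) / (q + S)) < 1 := by
            rw [one_mul, div_lt_one (by positivity)]; linarith
          rw [Real.arctan_add hlt]
          congr 1
          have hS0 : (S : ℝ) ≠ 0 := hSr.ne'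
          have hqS : (q : ℝ) + S ≠ 0 := by positivity
          have h2S : (q : ℝ) + S - ((q : ℝ) - S) ≠ 0 := by ring_nf; positivity
          field_simp
          ring
        rw [key]
        have := mem_add (mem_divNat hpi (show 0 < 4 by norm_num)) hA'
        push_cast at this
        exact this
      · simp at h
    · simp at h
  · split at h
    · rename_i A hA
      simp only [Option.some.injEq] at h
      subst h
      have hq : 2 * (S : ℝ) < q := by exact_mod_cast not_le.mp h2
      have hq0 : (0 : ℝ) < q := by linarith
      have hA' := mem_arctanSmall hS hA (mem_ofFrac S (S : ℤ) (q := q) (by exact_mod_cast hq0))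
      have key : Real.arctan ((q : ℝ) / S) = Real.pi / 2 - Real.arctan (((S : ℤ) : ℝ) / (q : ℕ)) := by
        have := Real.arctan_inv_of_pos (show (0 : ℝ) < (S : ℝ) / q by positivity)
        rw [inv_div] at this
        rw [this]
        push_cast
        ring
      rw [key]
      have := mem_sub (mem_divNat hpi (show 0 < 2 by norm_num)) hA'
      push_cast at this ⊢
      exact this
    · simp at h

/-- Enclosure of `arctan (p / S)` for any scaled point `p` (oddness for `p < 0`). [folklore] -/
def arctanPt (S K : ℕ) (piI : MI) (p : ℤ) : Option MI :=
  if 0 ≤ p then arctanNat S K piI p.toNat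
  else
    match arctanNat S K piI (-p).toNat with
    | some A => some A.neg
    | none => none

/-- [folklore] -/
theorem mem_arctanPt (hS : 0 < S) {K : ℕ} {piI : MI} (hpi : mem S Real.pi piI) {p : ℤ} {Z : MI}
    (h : arctanPt S K piI p = some Z) : mem S (Real.arctan ((p : ℝ) / S)) Z := by
  unfold arctanPt at h
  split_ifs at h with hp
  · have := mem_arctanNat hS hpi h
    have ep : ((p.toNat : ℕ) : ℝ) = (p : ℝ) := by
      have : (p.toNat : ℤ) = p := Int.toNat_of_nonneg hp
      exact_mod_cast this
    rwa [ep] at this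
  · split at h
    · rename_i A hA
      simp only [Option.some.injEq] at h
      subst h
      have := mem_arctanNat hS hpi hA
      have ep : (((-p).toNat : ℕ) : ℝ) = -(p : ℝ) := by
        have : ((-p).toNat : ℤ) = -p := Int.toNat_of_nonneg (by omega)
        exact_mod_cast this
      rw [ep, neg_div, Real.arctan_neg] at this
      have := mem_neg this
      rwa [neg_neg] at this
    · simp at h

/-- Enclosure of `arctan x` on an interval, by monotonicity between the endpoint values.
[folklore] -/
def arctan (S K : ℕ) (piI : MI) (X : MI) : Option MI :=
  match arctanPt S K piI X.lo, arctanPt S K piI X.hi with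
  | some A, some B => some ⟨A.lo, B.hi⟩
  | _, _ => none

/-- [folklore] -/
theorem mem_arctan (hS : 0 < S) {K : ℕ} {piI : MI} (hpi : mem S Real.pi piI) {Z : MI}
    (h : arctan S K piI X = some Z) (hx : mem S x X) : mem S (Real.arctan x) Z := by
  unfold arctan at h
  split at h
  · rename_i A B hA hB
    simp only [Option.some.injEq] at h
    subst h
    have hSr : (0 : ℝ) < S := by exact_mod_cast hS
    have hA' := mem_arctanPt hS hpi hA
    have hB' := mem_arctanPt hS hpi hB
    constructor
    · have h1 : Real.arctan ((X.lo : ℝ) / S) ≤ Real.arctan x :=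
        Real.arctan_mono (by rw [div_le_iff₀ hSr]; exact hx.1)
      simp only
      nlinarith [hA'.1]
    · have h1 : Real.arctan x ≤ Real.arctan ((X.hi : ℝ) / S) :=
        Real.arctan_mono (by rw [le_div_iff₀ hSr]; exact hx.2)
      simp only
      nlinarith [hB'.2]
  · simp at h

end MI

/-! ### The complex logarithm on the upper half-plane -/

/-- `arg z = π/2 − arctan (re z / im z)` for `im z > 0`. [folklore] -/
theorem arg_eq_pi_div_two_sub_arctan {z : ℂ} (hz : 0 < z.im) :
    Complex.arg z = Real.pi / 2 - Real.arctan (z.re / z.im) := by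
  rw [Complex.arg_of_im_pos hz, Real.arccos_eq_pi_div_two_sub_arcsin, Real.arctan_eq_arcsin]
  congr 2
  have hn : ‖z‖ = z.im * Real.sqrt (1 + (z.re / z.im) ^ 2) := by
    have h1 : 0 ≤ z.im * Real.sqrt (1 + (z.re / z.im) ^ 2) := by positivity
    rw [← Real.sqrt_sq (norm_nonneg _), ← Real.sqrt_sq h1]
    congr 1
    rw [mul_pow, Real.sq_sqrt (by positivity), Complex.sq_norm, Complex.normSq_apply]
    field_simp
    ring
  rw [hn]
  field_simp

namespace MC

variable {z : ℂ} {B : MC}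

/-- The principal logarithm of a box in the open upper half-plane (`none` unless `im > 0` is
certified): `re = ½ log (re² + im²)`, `im = π/2 − arctan (re/im)`. [folklore] -/
def logUpper (S K : ℕ) (piI : MI) (B : MC) : Option MC :=
  if 0 < B.im.lo then
    match MI.logPos S K (B.normSq S), MI.divPos S B.re B.im with
    | some Lr, some T =>
      match MI.arctan S K piI T with
      | some A => some ⟨Lr.divNat 2, (piI.divNat 2).sub A⟩
      | none => none
    | _, _ => none
  else none

/-- [folklore] -/
theorem mem_logUpper (hS : 0 < S) {K : ℕ} {piI : MI} (hpi : MI.mem S Real.pi piI) {Y : MC}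
    (h : logUpper S K piI B = some Y) (hz : mem S z B) : 0 < z.im ∧ mem S (Complex.log z) Y := by
  unfold logUpper at h
  split_ifs at h with him
  have hzi : 0 < z.im := MI.pos_of_lo_pos hz.2 him
  split at h
  · rename_i Lr T hL hT
    split at h
    · rename_i A hA
      simp only [Option.some.injEq] at h
      subst h
      refine ⟨hzi, ?_, ?_⟩
      · -- real part
        obtain ⟨hn0, hlog⟩ := MI.mem_logPos hS hL (mem_normSq hS hz)
        have e : (Complex.log z).re = Real.log (Complex.normSq z) / 2 := by
          rw [Complex.log_re, ← Complex.sq_norm, Real.log_pow]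
          push_cast
          ring
        simp only
        rw [e]
        exact MI.mem_divNat hlog (show 0 < 2 by norm_num)
      · -- imaginary part
        have ht := MI.mem_divPos hS hT hz.1 hz.2
        have hA' := MI.mem_arctan hS hpi hA ht
        have e : (Complex.log z).im = Real.pi / 2 - Real.arctan (z.re / z.im) := by
          rw [Complex.log_im, arg_eq_pi_div_two_sub_arctan hzi]
        simp only
        rw [e]
        have := MI.mem_sub (MI.mem_divNat hpi (show 0 < 2 by norm_num)) hA'
        push_cast at this
        exact this
    · simp at h
  · simp at h

end MC

/-! ### Kernel smoke test -/

/-- `log 3 ∈ (1.0986122, 1.0986124)` and `arctan 1 ∈ (0.7853981, 0.7853982)`, evaluated by the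
kernel at scale `2^64`. [folklore] -/
example :
    (match MI.logPos (2 ^ 64) 70 (MI.ofInt (2 ^ 64) 3),
        (MI.pi (2 ^ 64) 30).bind fun P ↦ MI.arctan (2 ^ 64) 70 P (MI.ofInt (2 ^ 64) 1) with
      | some L, some A => decide (10986122 * 2 ^ 64 < L.lo * 10 ^ 7 ∧ L.hi * 10 ^ 7 < 10986124 * 2 ^ 64 ∧
          7853981 * 2 ^ 64 < A.lo * 10 ^ 7 ∧ A.hi * 10 ^ 7 < 7853982 * 2 ^ 64)
      | _, _ => false) = true := by
  decide +kernel

end Literature.Analysis.ValidatedNumerics.NumericsMP
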